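import Mathlib
import HarnessLib
import Literature.Computability.AlgebraicComplexity.HessianRank
import Literature.Computability.AlgebraicComplexity.MignonRessayreBound

/-!
# Crux `RankDefectRepresentations` (stmt-PneNP-18923), line `rank-dehn-ladder`: the NUMBER OPERATOR LEMMA

A GLOBAL, polynomial-cost structure theorem for almost-representations (negative rung N0 of the line; lead g5).
Let `ε_0, …, ε_{n-1}` be IDEMPOTENT matrices (no commutation assumed) and `E = ∑ ε_i` their "number operator".  If
they commuted, `E` would be diagonalizable with spectrum in `{0, …, n}`, i.e. `∏_{k=0}^{n} (E − k) = 0`.  We prove the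
RANK-ROBUST version with a POLYNOMIAL constant (`rank_numberOperator_le`):

  pairwise commutators of rank `≤ t`  ⟹  `rank ((E − n)(E − (n−1)) ⋯ (E − 1) E) ≤ n³ · t`,

and more precisely `≤ n · ∑_j rank [ε_{j+1} + ⋯ + ε_{n−1}, ε_j]` (`rank_numberOperator_prod_le`).  The naive route (expand
into the `2^n` atoms `∏ ε_i^{±}` and sort each) pays `2^n · t`; here the atoms of each weight are aggregated at polynomial
cost — a construction that is neither an averaging nor a good-subspace argument (both useless in the rank metric,
`Cruxes/RankDefectRepresentations/Lines/rank-dehn-ladder-briefs.md` §g5).  Equivalently: the two-sided generation length of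
`∏_{m=0}^{n} (x_1 + ⋯ + x_n − n + 2m)` modulo the Boolean/commutator relations is `O(n²)`, not `2^n`.

Proof (a discrete "generating-function ODE", `(1+t) G'(t) = E·G(t) − C(t)` for `G(t) = ∏ (1 + t ε_i)`): with the ORDERED
elementary symmetric products `G_k(L) = ∑_{i_1<⋯<i_k} ε_{i_1}⋯ε_{i_k}` (here: `((L.sublistsLen k).map List.prod).sum`)
one has the exact recurrence `E_L · G_k(L) = (k+1) G_{k+1}(L) + k G_k(L) + c_k` where the error `c_k` lies in the left
module `M(L) = ∑_{j,b} Mat · [E_{>j}, ε_j] · G_b(L_{>j})` (`esum_mul_G`; only `ε² = ε` is used: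
`c_{k+1}(a :: L) = a c_k(L) + c_{k+1}(L) + [E_L, a] G_k(L)`); unrolling with `G_{n+1} = 0` puts `∏_k (E − k)` in `M(L)`
(`prod_mem`), and every element of `M(L)` has rank `≤ n ∑_j rank [E_{>j}, ε_j]` (`rank_le_of_mem`).
The file is definition-free: `M(L)` is spelled out as an existential over left cofactors.
HONEST FRAMING: a tool on the Negative/ lane (towards `stub_uniformStability`): it decomposes an almost-representation by
total weight only; the crux, GL_noncomm and P ≠ NP are not moved; F-N2 is a FRONTIER formal rung.
-/

set_option linter.dupNamespace false -- `Summit.PneNP.PneNP.…`: summit = sub-problem name (D-0017)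

namespace Summit.PneNP.PneNP.Theorems.CnfIdealGenLengthRankDefectRepresentationsNumberOperator

open Finset
open Literature.Computability.AlgebraicComplexity (rank_add_le rank_sum_le rank_smul_le)

variable {K : Type*} [Field K] {d : ℕ}

/-! ## Ordered elementary symmetric products `G_k(L) = ((L.sublistsLen k).map List.prod).sum` -/

/-- `G_0(L) = 1`. -/
theorem G_zero (L : List (Matrix (Fin d) (Fin d) K)) :
    ((L.sublistsLen 0).map List.prod).sum = 1 := by
  simp [List.sublistsLen_zero]

/-- `G_{k+1}([]) = 0`. -/
theorem G_nil_succ (k : ℕ) :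
    ((([] : List (Matrix (Fin d) (Fin d) K)).sublistsLen (k + 1)).map List.prod).sum = 0 := by
  simp [List.sublistsLen_succ_nil]

/-- Unfolding on a cons: `G_{k+1}(a :: L) = G_{k+1}(L) + a · G_k(L)`. -/
theorem G_cons_succ (a : Matrix (Fin d) (Fin d) K) (L : List (Matrix (Fin d) (Fin d) K)) (k : ℕ) :
    (((a :: L).sublistsLen (k + 1)).map List.prod).sum =
      ((L.sublistsLen (k + 1)).map List.prod).sum + a * ((L.sublistsLen k).map List.prod).sum := by
  rw [List.sublistsLen_succ_cons, List.map_append, List.sum_append, List.map_map]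
  congr 1
  simp only [Function.comp_def, List.prod_cons, List.sum_map_mul_left]

/-- `G_k(L) = 0` for `k > |L|`. -/
theorem G_eq_zero_of_length_lt (L : List (Matrix (Fin d) (Fin d) K)) (k : ℕ) (h : L.length < k) :
    ((L.sublistsLen k).map List.prod).sum = 0 := by
  rw [List.sublistsLen_of_length_lt h]; simp

/-- `G_1(L) = E_L`. -/
theorem G_one : ∀ L : List (Matrix (Fin d) (Fin d) K), ((L.sublistsLen 1).map List.prod).sum = L.sum
  | [] => by simp [List.sublistsLen_succ_nil]
  | a :: L => by rw [G_cons_succ, G_zero, mul_one, G_one L, List.sum_cons, add_comm]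

/-! ## The left module `M(L)` (spelled out) and its closure properties

`m ∈ M_N(L)` means: `∃ X : ℕ → ℕ → Mat`, `m = ∑_{j<N} ∑_{b<N} X j b · ([E_{L_{>j}}, L_j] · G_b(L_{>j}))`
with `L_{>j} = L.drop (j+1)`, `L_j = L.getD j 0`. -/

/-- `0 ∈ M(L)`. -/
theorem mem_zero (L : List (Matrix (Fin d) (Fin d) K)) (N : ℕ) :
    ∃ X : ℕ → ℕ → Matrix (Fin d) (Fin d) K, (0 : Matrix (Fin d) (Fin d) K) =
      ∑ j ∈ range N, ∑ b ∈ range N, X j b *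
        (((L.drop (j + 1)).sum * L.getD j 0 - L.getD j 0 * (L.drop (j + 1)).sum) *
          (((L.drop (j + 1)).sublistsLen b).map List.prod).sum) :=
  ⟨fun _ _ => 0, by simp⟩

/-- `M(L)` is closed under addition. -/
theorem mem_add {L : List (Matrix (Fin d) (Fin d) K)} {N : ℕ} {m m' : Matrix (Fin d) (Fin d) K}
    (h : ∃ X : ℕ → ℕ → Matrix (Fin d) (Fin d) K, m =
      ∑ j ∈ range N, ∑ b ∈ range N, X j b *
        (((L.drop (j + 1)).sum * L.getD j 0 - L.getD j 0 * (L.drop (j + 1)).sum) *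
          (((L.drop (j + 1)).sublistsLen b).map List.prod).sum))
    (h' : ∃ X : ℕ → ℕ → Matrix (Fin d) (Fin d) K, m' =
      ∑ j ∈ range N, ∑ b ∈ range N, X j b *
        (((L.drop (j + 1)).sum * L.getD j 0 - L.getD j 0 * (L.drop (j + 1)).sum) *
          (((L.drop (j + 1)).sublistsLen b).map List.prod).sum)) :
    ∃ X : ℕ → ℕ → Matrix (Fin d) (Fin d) K, m + m' =
      ∑ j ∈ range N, ∑ b ∈ range N, X j b *
        (((L.drop (j + 1)).sum * L.getD j 0 - L.getD j 0 * (L.drop (j + 1)).sum) *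
          (((L.drop (j + 1)).sublistsLen b).map List.prod).sum) := by
  obtain ⟨X, rfl⟩ := h; obtain ⟨X', rfl⟩ := h'
  exact ⟨fun j b => X j b + X' j b, by simp only [add_mul, sum_add_distrib]⟩

/-- `M(L)` is closed under left multiplication. -/
theorem mem_mul_left {L : List (Matrix (Fin d) (Fin d) K)} {N : ℕ} {m : Matrix (Fin d) (Fin d) K}
    (Z : Matrix (Fin d) (Fin d) K)
    (h : ∃ X : ℕ → ℕ → Matrix (Fin d) (Fin d) K, m =
      ∑ j ∈ range N, ∑ b ∈ range N, X j b *
        (((L.drop (j + 1)).sum * L.getD j 0 - L.getD j 0 * (L.drop (j + 1)).sum) *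
          (((L.drop (j + 1)).sublistsLen b).map List.prod).sum)) :
    ∃ X : ℕ → ℕ → Matrix (Fin d) (Fin d) K, Z * m =
      ∑ j ∈ range N, ∑ b ∈ range N, X j b *
        (((L.drop (j + 1)).sum * L.getD j 0 - L.getD j 0 * (L.drop (j + 1)).sum) *
          (((L.drop (j + 1)).sublistsLen b).map List.prod).sum) := by
  obtain ⟨X, rfl⟩ := h
  exact ⟨fun j b => Z * X j b, by simp only [mul_sum, mul_assoc]⟩

/-- `M(L)` is closed under scalars. -/
theorem mem_smul {L : List (Matrix (Fin d) (Fin d) K)} {N : ℕ} {m : Matrix (Fin d) (Fin d) K} (r : K)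
    (h : ∃ X : ℕ → ℕ → Matrix (Fin d) (Fin d) K, m =
      ∑ j ∈ range N, ∑ b ∈ range N, X j b *
        (((L.drop (j + 1)).sum * L.getD j 0 - L.getD j 0 * (L.drop (j + 1)).sum) *
          (((L.drop (j + 1)).sublistsLen b).map List.prod).sum)) :
    ∃ X : ℕ → ℕ → Matrix (Fin d) (Fin d) K, r • m =
      ∑ j ∈ range N, ∑ b ∈ range N, X j b *
        (((L.drop (j + 1)).sum * L.getD j 0 - L.getD j 0 * (L.drop (j + 1)).sum) *
          (((L.drop (j + 1)).sublistsLen b).map List.prod).sum) := by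
  obtain ⟨X, rfl⟩ := h
  exact ⟨fun j b => r • X j b, by simp only [smul_sum, smul_mul_assoc]⟩

/-- The generators `Z · [E_{>j}, L_j] · G_b(L_{>j})` (with `j, b < N`) lie in `M(L)`. -/
theorem mem_gen (L : List (Matrix (Fin d) (Fin d) K)) {N j b : ℕ} (hj : j < N) (hb : b < N)
    (Z : Matrix (Fin d) (Fin d) K) :
    ∃ X : ℕ → ℕ → Matrix (Fin d) (Fin d) K,
      Z * (((L.drop (j + 1)).sum * L.getD j 0 - L.getD j 0 * (L.drop (j + 1)).sum) *
          (((L.drop (j + 1)).sublistsLen b).map List.prod).sum) =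
      ∑ j ∈ range N, ∑ b ∈ range N, X j b *
        (((L.drop (j + 1)).sum * L.getD j 0 - L.getD j 0 * (L.drop (j + 1)).sum) *
          (((L.drop (j + 1)).sublistsLen b).map List.prod).sum) := by
  classical
  refine ⟨fun j' b' => if j' = j ∧ b' = b then Z else 0, ?_⟩
  rw [Finset.sum_eq_single_of_mem j (mem_range.2 hj), Finset.sum_eq_single_of_mem b (mem_range.2 hb)]
  · simp
  · intro b' _ hb'; simp [hb']
  · intro j' _ hj'
    refine Finset.sum_eq_zero fun b' _ => ?_
    simp [hj']

/-- Monotonicity along the list: `M_N(L) ⊆ M_{N+1}(a :: L)` (indices shift by one: `(a :: L)_{>j+1} = L_{>j}`). -/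
theorem mem_cons {L : List (Matrix (Fin d) (Fin d) K)} {N : ℕ} {m : Matrix (Fin d) (Fin d) K}
    (a : Matrix (Fin d) (Fin d) K)
    (h : ∃ X : ℕ → ℕ → Matrix (Fin d) (Fin d) K, m =
      ∑ j ∈ range N, ∑ b ∈ range N, X j b *
        (((L.drop (j + 1)).sum * L.getD j 0 - L.getD j 0 * (L.drop (j + 1)).sum) *
          (((L.drop (j + 1)).sublistsLen b).map List.prod).sum)) :
    ∃ X : ℕ → ℕ → Matrix (Fin d) (Fin d) K, m =
      ∑ j ∈ range (N + 1), ∑ b ∈ range (N + 1), X j b *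
        ((((a :: L).drop (j + 1)).sum * (a :: L).getD j 0 - (a :: L).getD j 0 * ((a :: L).drop (j + 1)).sum) *
          ((((a :: L).drop (j + 1)).sublistsLen b).map List.prod).sum) := by
  obtain ⟨X, rfl⟩ := h
  refine ⟨fun j b => if j = 0 then 0 else if b < N then X (j - 1) b else 0, ?_⟩
  rw [Finset.sum_range_succ' (fun j => ∑ b ∈ range (N + 1), _)]
  simp only [Nat.succ_ne_zero, if_false, if_true, zero_mul, sum_const_zero, add_zero, Nat.add_sub_cancel,
    List.drop_succ_cons, List.getD_cons_succ]
  refine Finset.sum_congr rfl fun j _ => ?_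
  rw [Finset.sum_range_succ]
  simp only [lt_self_iff_false, if_false, zero_mul, add_zero]
  exact Finset.sum_congr rfl fun b hb => by rw [if_pos (mem_range.1 hb)]

/-- **Rank bound for the module.** Every element of `M_N(L)` has rank `≤ N · ∑_{j<N} rank [E_{L_{>j}}, L_j]` (group the sum by
`(j,b)`: for fixed `(j,b)` all left cofactors multiply ONE matrix of rank `≤ rank [E_{>j}, L_j]`). [folklore] -/
theorem rank_le_of_mem {L : List (Matrix (Fin d) (Fin d) K)} {N : ℕ} {m : Matrix (Fin d) (Fin d) K}
    (h : ∃ X : ℕ → ℕ → Matrix (Fin d) (Fin d) K, m =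
      ∑ j ∈ range N, ∑ b ∈ range N, X j b *
        (((L.drop (j + 1)).sum * L.getD j 0 - L.getD j 0 * (L.drop (j + 1)).sum) *
          (((L.drop (j + 1)).sublistsLen b).map List.prod).sum)) :
    m.rank ≤ N * ∑ j ∈ range N, ((L.drop (j + 1)).sum * L.getD j 0 - L.getD j 0 * (L.drop (j + 1)).sum).rank := by
  obtain ⟨X, rfl⟩ := h
  calc (∑ j ∈ range N, ∑ b ∈ range N, X j b *
          (((L.drop (j + 1)).sum * L.getD j 0 - L.getD j 0 * (L.drop (j + 1)).sum) *
            (((L.drop (j + 1)).sublistsLen b).map List.prod).sum)).rank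
      ≤ ∑ j ∈ range N, (∑ b ∈ range N, X j b *
          (((L.drop (j + 1)).sum * L.getD j 0 - L.getD j 0 * (L.drop (j + 1)).sum) *
            (((L.drop (j + 1)).sublistsLen b).map List.prod).sum)).rank := rank_sum_le _ _
    _ ≤ ∑ j ∈ range N, ∑ b ∈ range N, (X j b *
          (((L.drop (j + 1)).sum * L.getD j 0 - L.getD j 0 * (L.drop (j + 1)).sum) *
            (((L.drop (j + 1)).sublistsLen b).map List.prod).sum)).rank :=
        Finset.sum_le_sum fun j _ => rank_sum_le _ _
    _ ≤ ∑ j ∈ range N, ∑ _b ∈ range N,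
          ((L.drop (j + 1)).sum * L.getD j 0 - L.getD j 0 * (L.drop (j + 1)).sum).rank := by
        refine Finset.sum_le_sum fun j _ => Finset.sum_le_sum fun b _ => ?_
        exact (Matrix.rank_mul_le_right _ _).trans (Matrix.rank_mul_le_left _ _)
    _ = N * ∑ j ∈ range N, ((L.drop (j + 1)).sum * L.getD j 0 - L.getD j 0 * (L.drop (j + 1)).sum).rank := by
        rw [Finset.mul_sum]
        refine Finset.sum_congr rfl fun j _ => ?_
        rw [Finset.sum_const, card_range, smul_eq_mul]

/-! ## The recurrence `E · G_k = (k+1) G_{k+1} + k G_k + c_k` with `c_k ∈ M(L)` -/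

/-- **The number-operator recurrence** (exact identity using only `ε² = ε`): for every list `L` of idempotents and
every `k`, `E_L · G_k(L) − (k+1) G_{k+1}(L) − k G_k(L)` lies in the left module `M(L)`. [folklore] -/
theorem esum_mul_G : ∀ (L : List (Matrix (Fin d) (Fin d) K)), (∀ a ∈ L, a * a = a) → ∀ k : ℕ,
    ∃ X : ℕ → ℕ → Matrix (Fin d) (Fin d) K,
      L.sum * ((L.sublistsLen k).map List.prod).sum
        - ((k : K) + 1) • ((L.sublistsLen (k + 1)).map List.prod).sum
        - (k : K) • ((L.sublistsLen k).map List.prod).sum =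
      ∑ j ∈ range L.length, ∑ b ∈ range L.length, X j b *
        (((L.drop (j + 1)).sum * L.getD j 0 - L.getD j 0 * (L.drop (j + 1)).sum) *
          (((L.drop (j + 1)).sublistsLen b).map List.prod).sum)
  | [], _, 0 => ⟨fun _ _ => 0, by simp [List.sublistsLen_zero, List.sublistsLen_succ_nil]⟩
  | [], _, k + 1 => ⟨fun _ _ => 0, by simp [List.sublistsLen_succ_nil]⟩
  | a :: L, hL, 0 => ⟨fun _ _ => 0, by simp [G_one, add_comm]⟩
  | a :: L, hL, k + 1 => by
      have ha : a * a = a := hL a (by simp)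
      have hL' : ∀ b ∈ L, b * b = b := fun b hb => hL b (by simp [hb])
      obtain ⟨X0, h0⟩ := esum_mul_G L hL' k
      obtain ⟨X1, h1⟩ := esum_mul_G L hL' (k + 1)
      -- abbreviations for readability inside the proof
      set Gk := ((L.sublistsLen k).map List.prod).sum with hGk
      set Gk1 := ((L.sublistsLen (k + 1)).map List.prod).sum with hGk1
      set Gk2 := ((L.sublistsLen (k + 2)).map List.prod).sum with hGk2
      set c0 := L.sum * Gk - ((k : K) + 1) • Gk1 - (k : K) • Gk with hc0
      set c1 := L.sum * Gk1 - ((↑(k + 1) : K) + 1) • Gk2 - ((↑(k + 1) : K)) • Gk1 with hc1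
      -- the three pieces of `c_{k+1}(a :: L) = a c_k(L) + c_{k+1}(L) + [E_L, a] G_k(L)` lie in the shifted module
      have m0 := mem_mul_left a (mem_cons (N := L.length) a ⟨X0, h0⟩)
      have m1 := mem_cons (N := L.length) a ⟨X1, h1⟩
      have m2 : ∃ X : ℕ → ℕ → Matrix (Fin d) (Fin d) K, (L.sum * a - a * L.sum) * Gk =
          ∑ j ∈ range (L.length + 1), ∑ b ∈ range (L.length + 1), X j b *
            ((((a :: L).drop (j + 1)).sum * (a :: L).getD j 0 - (a :: L).getD j 0 * ((a :: L).drop (j + 1)).sum) *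
              ((((a :: L).drop (j + 1)).sublistsLen b).map List.prod).sum) := by
        by_cases hk : k < L.length + 1
        · have := mem_gen (a :: L) (N := L.length + 1) (j := 0) (b := k) (Nat.succ_pos _) hk 1
          simpa using this
        · rw [hGk, G_eq_zero_of_length_lt L k (by omega), mul_zero]
          exact mem_zero _ _
      obtain ⟨X, hX⟩ := mem_add (mem_add m0 m1) m2
      refine ⟨X, ?_⟩
      rw [List.length_cons, ← hX]
      -- algebra: expand everything in terms of Gk, Gk1, Gk2 and use `a² = a`
      rw [List.sum_cons, G_cons_succ, G_cons_succ, ← hGk, ← hGk1, ← hGk2, hc0, hc1]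
      have hexp : (a + L.sum) * (Gk1 + a * Gk)
          = a * Gk1 + a * Gk + a * (L.sum * Gk) + (L.sum * a - a * L.sum) * Gk + L.sum * Gk1 := by
        rw [show (a + L.sum) * (Gk1 + a * Gk)
            = a * Gk1 + a * a * Gk + L.sum * a * Gk + L.sum * Gk1 by noncomm_ring, ha]
        noncomm_ring
      rw [hexp]
      simp only [mul_sub, mul_smul_comm, smul_add, push_cast]
      module

/-! ## Unrolling: the descending product `(E − n) ⋯ (E − 0)` lies in `M(L)` -/

/-- Unrolling the recurrence downwards from `(n+1)! G_{n+1} = 0`: for `i ≤ n+1`,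
`(E−n)(E−(n−1))⋯(E−(n−i+1)) · (n+1−i)! G_{n+1−i}(L) − (n+1)! G_{n+1}(L) ∈ M(L)`. -/
theorem unroll (L : List (Matrix (Fin d) (Fin d) K)) (hL : ∀ a ∈ L, a * a = a) :
    ∀ i : ℕ, i ≤ L.length + 1 →
      ∃ X : ℕ → ℕ → Matrix (Fin d) (Fin d) K,
        ((List.range i).map fun l => L.sum - ((L.length - l : ℕ) : K) • (1 : Matrix (Fin d) (Fin d) K)).prod *
            (((L.length + 1 - i).factorial : K) • ((L.sublistsLen (L.length + 1 - i)).map List.prod).sum)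
          - ((L.length + 1).factorial : K) • ((L.sublistsLen (L.length + 1)).map List.prod).sum =
        ∑ j ∈ range L.length, ∑ b ∈ range L.length, X j b *
          (((L.drop (j + 1)).sum * L.getD j 0 - L.getD j 0 * (L.drop (j + 1)).sum) *
            (((L.drop (j + 1)).sublistsLen b).map List.prod).sum) := by
  intro i
  induction i with
  | zero =>
      intro _
      simp only [List.range_zero, List.map_nil, List.prod_nil, one_mul, tsub_zero, sub_self]
      exact mem_zero _ _
  | succ i ih =>
      intro hi
      obtain ⟨X', ih'⟩ := ih (by omega)
      set n := L.length with hn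
      set m := n - i with hm
      have hm1 : n + 1 - i = m + 1 := by omega
      have hm2 : n + 1 - (i + 1) = m := by omega
      rw [hm1] at ih'
      rw [hm2]
      set Pi := ((List.range i).map fun l => L.sum - ((n - l : ℕ) : K) • (1 : Matrix (Fin d) (Fin d) K)).prod
        with hPi
      have hP : ((List.range (i + 1)).map fun l => L.sum - ((n - l : ℕ) : K) • (1 : Matrix (Fin d) (Fin d) K)).prod
          = Pi * (L.sum - ((m : ℕ) : K) • (1 : Matrix (Fin d) (Fin d) K)) := by
        rw [List.range_succ, List.map_append, List.prod_append, List.map_singleton, List.prod_singleton, hm]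
      obtain ⟨Xr, hrec⟩ := esum_mul_G L hL m
      set Gm := ((L.sublistsLen m).map List.prod).sum with hGm
      set Gm1 := ((L.sublistsLen (m + 1)).map List.prod).sum with hGm1
      set cm := L.sum * Gm - ((m : K) + 1) • Gm1 - (m : K) • Gm with hcm
      -- (E - m) (m! G_m) = (m+1)! G_{m+1} + m! c_m
      have key : Pi * (L.sum - ((m : ℕ) : K) • (1 : Matrix (Fin d) (Fin d) K)) * (((m.factorial : ℕ) : K) • Gm)
          = Pi * ((((m + 1).factorial : ℕ) : K) • Gm1) + Pi * (((m.factorial : ℕ) : K) • cm) := by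
        rw [mul_assoc, ← mul_add]
        congr 1
        rw [sub_mul, smul_mul_assoc, one_mul, mul_smul_comm, hcm, Nat.factorial_succ, Nat.cast_mul]
        simp only [smul_sub, smul_smul]
        push_cast
        module
      have hcmem : ∃ X : ℕ → ℕ → Matrix (Fin d) (Fin d) K, Pi * (((m.factorial : ℕ) : K) • cm) =
          ∑ j ∈ range n, ∑ b ∈ range n, X j b *
            (((L.drop (j + 1)).sum * L.getD j 0 - L.getD j 0 * (L.drop (j + 1)).sum) *
              (((L.drop (j + 1)).sublistsLen b).map List.prod).sum) :=
        mem_mul_left Pi (mem_smul _ ⟨Xr, hrec⟩)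
      obtain ⟨X, hX⟩ := mem_add ⟨X', ih'⟩ hcmem
      refine ⟨X, ?_⟩
      rw [← hX, hP, key]
      abel

/-- **Number operator lemma (module form).** For a list `L` of idempotents with `E = ∑ L` and `n = |L|`:
`(E − n)(E − (n−1)) ⋯ (E − 0) ∈ M(L)`. [folklore] -/
theorem prod_mem (L : List (Matrix (Fin d) (Fin d) K)) (hL : ∀ a ∈ L, a * a = a) :
    ∃ X : ℕ → ℕ → Matrix (Fin d) (Fin d) K,
      ((List.range (L.length + 1)).map fun l =>
          L.sum - ((L.length - l : ℕ) : K) • (1 : Matrix (Fin d) (Fin d) K)).prod =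
      ∑ j ∈ range L.length, ∑ b ∈ range L.length, X j b *
        (((L.drop (j + 1)).sum * L.getD j 0 - L.getD j 0 * (L.drop (j + 1)).sum) *
          (((L.drop (j + 1)).sublistsLen b).map List.prod).sum) := by
  obtain ⟨X, h⟩ := unroll L hL (L.length + 1) le_rfl
  refine ⟨X, ?_⟩
  rw [← h, Nat.sub_self, Nat.factorial_zero, Nat.cast_one, one_smul, G_zero, mul_one,
    G_eq_zero_of_length_lt L (L.length + 1) (Nat.lt_succ_self _), smul_zero, sub_zero]

/-! ## The rank statements -/

/-- **NUMBER OPERATOR LEMMA (fine form).** For a list `L = [ε_0, …, ε_{n−1}]` of idempotent matrices with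
`E = ∑ ε_i`: `rank ((E − n)(E − (n−1)) ⋯ (E − 0)) ≤ n · ∑_{j<n} rank [ε_{j+1} + ⋯ + ε_{n−1}, ε_j]`. [folklore] -/
theorem rank_numberOperator_prod_le (L : List (Matrix (Fin d) (Fin d) K)) (hL : ∀ a ∈ L, a * a = a) :
    (((List.range (L.length + 1)).map fun l =>
        L.sum - ((L.length - l : ℕ) : K) • (1 : Matrix (Fin d) (Fin d) K)).prod).rank ≤
      L.length * ∑ j ∈ range L.length,
        ((L.drop (j + 1)).sum * L.getD j 0 - L.getD j 0 * (L.drop (j + 1)).sum).rank :=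
  rank_le_of_mem (prod_mem L hL)

/-- The commutator with a tail sum is bounded by the pairwise commutators. [folklore] -/
theorem rank_comm_sum_le (a : Matrix (Fin d) (Fin d) K) :
    ∀ (T : List (Matrix (Fin d) (Fin d) K)) (t : ℕ), (∀ b ∈ T, (b * a - a * b).rank ≤ t) →
      (T.sum * a - a * T.sum).rank ≤ T.length * t
  | [], t, _ => by simp
  | b :: T, t, h => by
      rw [List.sum_cons, List.length_cons,
        show (b + T.sum) * a - a * (b + T.sum) = (b * a - a * b) + (T.sum * a - a * T.sum) by noncomm_ring]
      refine (rank_add_le _ _).trans ?_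
      have h1 := h b (by simp)
      have h2 := rank_comm_sum_le a T t fun b' hb' => h b' (by simp [hb'])
      calc (b * a - a * b).rank + (T.sum * a - a * T.sum).rank ≤ t + T.length * t := Nat.add_le_add h1 h2
        _ = (T.length + 1) * t := by ring

/-- Pairwise form on lists. [folklore] -/
theorem rank_numberOperator_prod_le_of_pairwise (L : List (Matrix (Fin d) (Fin d) K)) (hL : ∀ a ∈ L, a * a = a)
    (t : ℕ) (ht : ∀ a ∈ L, ∀ b ∈ L, (a * b - b * a).rank ≤ t) :
    (((List.range (L.length + 1)).map fun l =>
        L.sum - ((L.length - l : ℕ) : K) • (1 : Matrix (Fin d) (Fin d) K)).prod).rank ≤ L.length ^ 3 * t := by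
  refine (rank_numberOperator_prod_le L hL).trans ?_
  have hj : ∀ j ∈ range L.length,
      ((L.drop (j + 1)).sum * L.getD j 0 - L.getD j 0 * (L.drop (j + 1)).sum).rank ≤ L.length * t := by
    intro j hj
    have hjl : j < L.length := mem_range.1 hj
    have hmem : L.getD j 0 ∈ L := by
      rw [List.getD_eq_getElem _ _ hjl]; exact List.getElem_mem hjl
    have h1 := rank_comm_sum_le (L.getD j 0) (L.drop (j + 1)) t fun b hb =>
      ht b (List.mem_of_mem_drop hb) _ hmem
    exact h1.trans (Nat.mul_le_mul_right t (by simp))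
  calc L.length * ∑ j ∈ range L.length, ((L.drop (j + 1)).sum * L.getD j 0 - L.getD j 0 * (L.drop (j + 1)).sum).rank
      ≤ L.length * ∑ _j ∈ range L.length, L.length * t := Nat.mul_le_mul_left _ (Finset.sum_le_sum hj)
    _ = L.length ^ 3 * t := by rw [Finset.sum_const, card_range, smul_eq_mul]; ring

/-- **NUMBER OPERATOR LEMMA.** Let `ε_0, …, ε_{n−1}` be idempotent `d × d` matrices over a field whose pairwise
commutators have rank `≤ t`, and `E = ∑_i ε_i`.  Then `rank ((E − n)(E − (n−1)) ⋯ (E − 1)(E − 0)) ≤ n³ · t`, whereas for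
COMMUTING idempotents the product vanishes: the number operator of an almost-representation of the Boolean/commutator
presentation is within rank `n³ t` of a diagonalizable operator with spectrum in `{0, …, n}` (restrict to the kernel
of the product, an `E`-invariant subspace of codimension `≤ n³ t`). [folklore] -/
theorem rank_numberOperator_le {n : ℕ} (ε : Fin n → Matrix (Fin d) (Fin d) K) (hε : ∀ i, ε i * ε i = ε i) (t : ℕ)
    (ht : ∀ i j, (ε i * ε j - ε j * ε i).rank ≤ t) :
    (((List.range (n + 1)).map fun l =>
        (∑ i, ε i) - ((n - l : ℕ) : K) • (1 : Matrix (Fin d) (Fin d) K)).prod).rank ≤ n ^ 3 * t := by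
  set L : List (Matrix (Fin d) (Fin d) K) := List.ofFn ε with hLdef
  have hlen : L.length = n := by simp [hLdef]
  have hsum : L.sum = ∑ i, ε i := by simp [hLdef, List.sum_ofFn]
  have hmem : ∀ a ∈ L, ∃ i, ε i = a := fun a ha => by
    simpa [hLdef, List.mem_ofFn] using ha
  have hL : ∀ a ∈ L, a * a = a := fun a ha => by
    obtain ⟨i, rfl⟩ := hmem a ha; exact hε i
  have ht' : ∀ a ∈ L, ∀ b ∈ L, (a * b - b * a).rank ≤ t := fun a ha b hb => by
    obtain ⟨i, rfl⟩ := hmem a ha; obtain ⟨j, rfl⟩ := hmem b hb; exact ht i j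
  have h := rank_numberOperator_prod_le_of_pairwise L hL t ht'
  rw [hlen, hsum] at h
  exact h

end Summit.PneNP.PneNP.Theorems.CnfIdealGenLengthRankDefectRepresentationsNumberOperator
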